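/-
Copyright (c) 2026 the pub-hodgecm-mathlib formalisation cell (harness21).  Prover seat hodgecm-mathlib-LH4-p11 (g10) (Track A «FOUR-FRAME» free hand
routed to L1 by LH4 dealer WORD #132 (4) ∕ CHAIR VALVE W4; LEAD F0P6-plan (g14) BATCH #105 (2) lineage, offer (i) of the ★ p862839 line 2026-09-04T23:01:31Z),
Track B «K2-LIT», #184♮ = hLiu418 = `stmt-HodgeConjecture-24832`; line lead K2E5-p16 (g8).  THE `hhead` PRODUCER of ★ p862839
`K2LiuRankOneSingularValuePresentation.exists_Eac_valuePresentation_scalarK1_cm`: ★ G1's Euler HEAD over `H_∞ × ∏_{v∈T} H_v` factorises place by place for a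
PURE-TENSOR head section (product Fubini, hypothesis-free).  THEOREMS ONLY (no `def`, no instance, no notation, no named-fact hypothesis, no `sorry`, default heartbeats).
-/
import Mathlib.MeasureTheory.Integral.Pi
import HarnessLib

/-!
# Crux `HLiu418`, road `K2_Liu`, socket #41 KIND 1 a♮ — THE EULER HEAD FACTORISES OVER THE PLACES OF `T ∪ ∞` FOR A PURE-TENSOR HEAD SECTION
# (`HEAD_T(s, h) = A_∞(s, h) · ∏_{v∈T} W_v(s, h)`), and the `hhead` letter of ★ p862839 at `s = ½`

Cell `hodgecm-mathlib`, crux item hLiu418 = `stmt-HodgeConjecture-24832`, route `HCCMUnconditional`; squad K2 ∕ K2Liu, LEAD F0P6-plan (g14), line lead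
K2E5-p16 (g8).  Lane `--supports stmt-HodgeConjecture-24832 --as helper` (count-neutral).  CLOSES NO SOCKET.

THE SETTING.  ★ G1 `K2LiuWhittakerDeltaEulerProduct.whittakerDelta_eq_mul_tprod_euler` writes the ψ_S-Whittaker coefficient of a section `f` factorizable OFF the finite
set `T` as `HEAD_T(s, h) · ∏'_{v∉T} W°_v(s)`, where the HEAD is ONE integral over the product group `N_Δ(L⁺⊗ℝ) × ∏_{v∈T} N_Δ(L⁺_v)` against the product measure
`νinf.prod (Measure.pi νv)` of the integrand
  `p ↦ (conj ψ_S(arch p.1) · ∏_{v:T} conj ψ_S(loc_v p.2 v)) · fT s (w_∞·p.1·h_∞, v ↦ w_v·(p.2 v)·h_v)`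
(`fT s` the head section on `H_∞ × ∏_{v∈T} H_v`).  The `hdead` road (★ p862379) and the `hpres` package (★ p862839, letter `hhead`) need this head, AT `s = ½`, as a
PRODUCT OVER PLACES `cT h · (∏_{w} A h w) · ∏_{v∈T} W₀ h v`.  For a PURE-TENSOR head section — `fT s (b, y) = f_∞ s b · ∏_{v:T} f_v s v (y v)` (the (o1) constructor's
choice `φ = ⊗_v φ_v`; BY VALUE here as `hpure`) — this is Fubini for products of functions on product spaces, which in Mathlib is HYPOTHESIS-FREE
(`MeasureTheory.integral_prod_mul`, `MeasureTheory.integral_fintype_prod_eq_prod`: both sides vanish together when a factor is not integrable):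
  `HEAD_T(s, h) = [∫ conj ψ(arch a) · f_∞ s (w_∞·a·h_∞) ∂νinf] · ∏_{v:T} ∫ conj ψ(loc_v y) · f_v s v (w_v·y·h_v) ∂(νv v)`.
* §1 `integral_prod_pi_mul_prod` — `∫ F(p.1)·∏_i G i (p.2 i) ∂(μ.prod (Measure.pi ν)) = (∫ F ∂μ) · ∏_i ∫ G i ∂(ν i)` (σ-finite letters only).
* §2 **`integral_charTensor_mul_pureTensor_eq`** — ★ G1's head SHAPE (character tensor × head section evaluated at translated arguments) for a pure-tensor `fT`:
  `= (∫ ψA a · fA (X a) ∂μ) · ∏_i ∫ ψ i y · f i (Y i y) ∂(ν i)`; the `s`-family ∕ `h`-parametrised form **`head_eq_archFactor_mul_prod_of_pureTensor`**: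
  `HT s h = A∞ s h · ∏_i W i s h` for all `s, h` once `HT` IS that integral (`hHT`) and `fT s` is a pure tensor (`hpure`).
* §3 **`hhead_of_pureTensor`** — at `s = ½`, with the archimedean factor further split over the real places BY VALUE (`hsplit : A∞ ½ h = c h · ∏_{w∈Tinf} A h w`, the arch
  lineage's letter ★ p862699-side), the `hhead` binder of ★ p862839 VERBATIM: `HT ½ h = c h · (∏_{w∈Tinf} A h w) · ∏_{v∈univ} W₀ h v` with `W₀ h v := W v ½ h` (`Tf := univ`
  over the index type of `T`; re-index to `∏ v ∈ T` by ★ p862839 `eulerValue_of_head_fintype` ∕ `Finset.prod_coe_sort` when `T` is a coerced `Finset`).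
HONEST LABEL.  Count-neutral helper (pure measure-theoretic bookkeeping; the pure-tensor letter `hpure` and the arch split `hsplit` enter BY VALUE); `HC_CM` is proved only
modulo the 7 printed citations (2 remaining named inputs: hLiu418 = `stmt-HodgeConjecture-24832`, h413 = `stmt-HodgeConjecture-24833`) until rung 0 closes.

## References
* [Tate1967] J. Tate, *Fourier analysis in number fields and Hecke's zeta-functions* (Cassels–Fröhlich 1967), §3 (restricted products, factorizable functions), Thm. 3.3.1.
* [KudlaRallis1994] S. Kudla, S. Rallis, *A regularized Siegel–Weil formula: the first term identity*, Ann. of Math. 140 (1994): §2 (Euler factorisation of Whittaker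
  coefficients of factorizable sections).
* [Shimura1997] G. Shimura, *Euler Products and Eisenstein Series*, CBMS 93 (1997), §18.4–18.5.
-/

set_option autoImplicit false
set_option linter.dupNamespace false -- the mandated namespace repeats `HodgeConjecture.HodgeConjecture`

noncomputable section

open MeasureTheory

namespace Summit.HodgeConjecture.HodgeConjecture.Cruxes.HLiu418.K2LiuRankOneSingularHeadFactorisation

/-! ## §1 Product Fubini over `μ.prod (Measure.pi ν)` -/

/-- **PRODUCT FUBINI, `A × ∏_i E i`.**  For σ-finite `μ` on `A` and `ν i` on `E i` (`i` in a finite type) and scalar functions `F`, `G i`: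
`∫ F(p.1) · ∏_i G i (p.2 i) ∂(μ.prod (Measure.pi ν)) = (∫ F ∂μ) · ∏_i ∫ G i ∂(ν i)` — `integral_prod_mul` then `integral_fintype_prod_eq_prod`; NO integrability hypothesis
(both sides vanish together). [cite: Tate1967, §3 Thm. 3.3.1] -/
theorem integral_prod_pi_mul_prod {A ι : Type*} [Fintype ι] {E : ι → Type*} [MeasurableSpace A] [∀ i, MeasurableSpace (E i)]
    (μ : Measure A) (ν : ∀ i, Measure (E i)) [SigmaFinite μ] [∀ i, SigmaFinite (ν i)] (F : A → ℂ) (G : ∀ i, E i → ℂ) :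
    ∫ p : A × (∀ i, E i), F p.1 * ∏ i, G i (p.2 i) ∂(μ.prod (Measure.pi ν)) = (∫ a, F a ∂μ) * ∏ i, ∫ y, G i y ∂(ν i) := by
  rw [integral_prod_mul (μ := μ) (ν := Measure.pi ν) F (fun t : ∀ i, E i => ∏ i, G i (t i)), integral_fintype_prod_eq_prod]

/-! ## §2 ★ G1's head shape for a pure-tensor head section -/

/-- **THE HEAD FACTORISES FOR A PURE TENSOR (★ G1's integrand shape).**  Character tensor `ψA(p.1) · ∏_i ψ i (p.2 i)` times the head section `fT` evaluated at the translated
arguments `(X p.1, i ↦ Y i (p.2 i))`; if `fT (b, y) = fA b · ∏_i f i (y i)` (pure tensor at `∞ × T`), the integral over `μ.prod (Measure.pi ν)` is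
`(∫ ψA a · fA (X a) ∂μ) · ∏_i ∫ ψ i y · f i (Y i y) ∂(ν i)`. [cite: KudlaRallis1994, §2] [cite: Tate1967, §3 Thm. 3.3.1] -/
theorem integral_charTensor_mul_pureTensor_eq {A B ι : Type*} [Fintype ι] {E Y : ι → Type*} [MeasurableSpace A] [∀ i, MeasurableSpace (E i)]
    (μ : Measure A) (ν : ∀ i, Measure (E i)) [SigmaFinite μ] [∀ i, SigmaFinite (ν i)]
    (ψA : A → ℂ) (ψ : ∀ i, E i → ℂ) (X : A → B) (Yf : ∀ i, E i → Y i) (fT : B × (∀ i, Y i) → ℂ) (fA : B → ℂ) (f : ∀ i, Y i → ℂ)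
    (hpure : ∀ b y, fT (b, y) = fA b * ∏ i, f i (y i)) :
    ∫ p : A × (∀ i, E i), (ψA p.1 * ∏ i, ψ i (p.2 i)) * fT (X p.1, fun i => Yf i (p.2 i)) ∂(μ.prod (Measure.pi ν)) =
      (∫ a, ψA a * fA (X a) ∂μ) * ∏ i, ∫ y, ψ i y * f i (Yf i y) ∂(ν i) := by
  have hint : ∀ p : A × (∀ i, E i),
      (ψA p.1 * ∏ i, ψ i (p.2 i)) * fT (X p.1, fun i => Yf i (p.2 i)) = (ψA p.1 * fA (X p.1)) * ∏ i, (ψ i (p.2 i) * f i (Yf i (p.2 i))) := by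
    intro p
    rw [hpure, Finset.prod_mul_distrib]
    ring
  simp_rw [hint]
  exact integral_prod_pi_mul_prod μ ν (fun a => ψA a * fA (X a)) (fun i y => ψ i y * f i (Yf i y))

/-- **THE `s`-FAMILY, `h`-PARAMETRISED HEAD FACTORISATION.**  If the head IS ★ G1's integral (`hHT`, the translated arguments depending on the adelic point `h`) and the
head section `fT s` is a pure tensor for every `s` (`hpure`), then `HT s h = A∞ s h · ∏_i W i s h` for ALL `s, h` with the archimedean factor
`A∞ s h = ∫ ψA a · fA s (X h a) ∂μ` and the local factors `W i s h = ∫ ψ i y · f s i (Y h i y) ∂(ν i)` (as `∃ A∞ W` with their defining equations exported — (F-V) transparent).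
[cite: KudlaRallis1994, §2] [cite: Shimura1997, §18.4] -/
theorem head_eq_archFactor_mul_prod_of_pureTensor {H A B ι : Type*} [Fintype ι] {E Y : ι → Type*} [MeasurableSpace A] [∀ i, MeasurableSpace (E i)]
    (μ : Measure A) (ν : ∀ i, Measure (E i)) [SigmaFinite μ] [∀ i, SigmaFinite (ν i)]
    (ψA : A → ℂ) (ψ : ∀ i, E i → ℂ) (X : H → A → B) (Yf : H → ∀ i, E i → Y i)
    (fT : ℂ → B × (∀ i, Y i) → ℂ) (fA : ℂ → B → ℂ) (f : ℂ → ∀ i, Y i → ℂ)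
    (hpure : ∀ s b y, fT s (b, y) = fA s b * ∏ i, f s i (y i))
    (HT : ℂ → H → ℂ)
    (hHT : ∀ s h, HT s h = ∫ p : A × (∀ i, E i), (ψA p.1 * ∏ i, ψ i (p.2 i)) * fT s (X h p.1, fun i => Yf h i (p.2 i)) ∂(μ.prod (Measure.pi ν))) :
    ∃ Ainf : ℂ → H → ℂ, ∃ W : ι → ℂ → H → ℂ,
      (∀ s h, Ainf s h = ∫ a, ψA a * fA s (X h a) ∂μ) ∧
      (∀ i s h, W i s h = ∫ y, ψ i y * f s i (Yf h i y) ∂(ν i)) ∧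
      ∀ s h, HT s h = Ainf s h * ∏ i, W i s h := by
  refine ⟨fun s h => ∫ a, ψA a * fA s (X h a) ∂μ, fun i s h => ∫ y, ψ i y * f s i (Yf h i y) ∂(ν i), fun _ _ => rfl, fun _ _ _ => rfl, fun s h => ?_⟩
  rw [hHT s h]
  exact integral_charTensor_mul_pureTensor_eq μ ν ψA ψ (X h) (Yf h) (fT s) (fA s) (f s) (hpure s)

/-! ## §3 The `hhead` letter of ★ p862839 at `s = ½` -/

/-- **`hhead` FROM A PURE TENSOR** (the letter of ★ p862839 `exists_Eac_valuePresentation_scalarK1_cm` VERBATIM, `Tf := Finset.univ`).  With the head AS ★ G1's integral (`hHT`),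
a pure-tensor head section (`hpure`), and the archimedean factor at the centre split over the real places BY VALUE (`hsplit : ∫ ψA a · fA ½ (X h a) ∂μ = c h · ∏_{w∈Tinf} A h w`,
the arch lineage's letter): `HT ½ h = c h · (∏_{w∈Tinf} A h w) · ∏_{v∈univ} W₀ h v` with `W₀ h v = ∫ ψ v y · f ½ v (Y h v y) ∂(ν v)` — as `∃ W₀` with its equation exported.
[cite: KudlaRallis1994, §2] [cite: Shimura1997, §18.4] -/
theorem hhead_of_pureTensor {H A B α ι : Type*} [Fintype ι] {E Y : ι → Type*} [MeasurableSpace A] [∀ i, MeasurableSpace (E i)]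
    (μ : Measure A) (ν : ∀ i, Measure (E i)) [SigmaFinite μ] [∀ i, SigmaFinite (ν i)]
    (ψA : A → ℂ) (ψ : ∀ i, E i → ℂ) (X : H → A → B) (Yf : H → ∀ i, E i → Y i)
    (fT : ℂ → B × (∀ i, Y i) → ℂ) (fA : ℂ → B → ℂ) (f : ℂ → ∀ i, Y i → ℂ)
    (hpure : ∀ s b y, fT s (b, y) = fA s b * ∏ i, f s i (y i))
    (HT : ℂ → H → ℂ)
    (hHT : ∀ s h, HT s h = ∫ p : A × (∀ i, E i), (ψA p.1 * ∏ i, ψ i (p.2 i)) * fT s (X h p.1, fun i => Yf h i (p.2 i)) ∂(μ.prod (Measure.pi ν)))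
    (Tinf : Finset α) (Aw : H → α → ℂ) (c : H → ℂ)
    (hsplit : ∀ h, ∫ a, ψA a * fA (1 / 2) (X h a) ∂μ = c h * ∏ w ∈ Tinf, Aw h w) :
    ∃ W₀ : H → ι → ℂ, (∀ h v, W₀ h v = ∫ y, ψ v y * f (1 / 2) v (Yf h v y) ∂(ν v)) ∧
      ∀ h, HT (1 / 2) h = c h * (∏ w ∈ Tinf, Aw h w) * ∏ v ∈ Finset.univ, W₀ h v := by
  refine ⟨fun h v => ∫ y, ψ v y * f (1 / 2) v (Yf h v y) ∂(ν v), fun _ _ => rfl, fun h => ?_⟩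
  rw [hHT, integral_charTensor_mul_pureTensor_eq μ ν ψA ψ (X h) (Yf h) (fT (1 / 2)) (fA (1 / 2)) (f (1 / 2)) (hpure (1 / 2)), hsplit h]

end Summit.HodgeConjecture.HodgeConjecture.Cruxes.HLiu418.K2LiuRankOneSingularHeadFactorisation

end
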